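import Summits.Ventures.Crystal3D.Theorems.StickyWulffConstantNoReconstructionGainGrainFrameBudgetThree
import Summits.Ventures.Crystal3D.Theorems.StickyWulffConstantNoReconstructionGainGrainFrame
import HarnessLib

/-!
# Misoriented fcc-grain films gain nothing, at every normal (rung `grainFilm_slab` by name)

HONEST FRAMING. Part of the venture `Summits/Ventures/Crystal3D` (cell `crystal3d-full`), helper
`--supports` the crux `NoReconstructionGain` (stmt-Ventures-19144, route
`route-Ventures-StickyWulffConstant`), line `adhesion` (wulff-p1 g12).  THE COMPOSITION OF SKELETON
v15 MADE UNCONDITIONAL: the cap budget `stub_frameCapBudget` (`…GrainFrameBudgetThree`, this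
generation) fed into the rung `grainFilm_slab_of_capBudget` (`…GrainFrame`, g11).

* `grainFilm_slab` (**rung, registered by name on stmt-Ventures-19144**) — CLASS (iii) OF THE LINE'S
  CENSUS, UNCONDITIONALLY: for every twelve-direction bond star `U₀` of `Λ₀` and every rigid motion
  `A`, at EVERY unit normal `ν` and every `ρ ≥ R`: a finite unit packing `X ⊇ P` containing the fcc
  slab sample `P`, whose film balls `q ∈ X ∖ P` lie above the cut (`−R < ⟪q, ν⟫`), off the substrate
  lattice (`q ∉ Λ₀`), and are bonded among themselves only along the moved lattice (`A⁻¹(x − q) ∈ Λ₀`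
  for touching film balls) — i.e. an arbitrarily ORIENTED AND POSITIONED fcc grain (or any subset of
  one) resting on the substrate — satisfies `#cross(P, X∖P) ≤ D(X∖P) + C ρ` with the constants of the
  rung (`C = 0` in `…GrainFrame`): the film gains nothing over the two flat faces.

WHAT THIS IS NOT: the crux.  Films with bonds outside one moved lattice (polycrystalline / amorphous
adsorbates, twins inside the film) and on-lattice coincidence films (`q ∈ Λ₀`, handled by the lattice
rungs) are not covered here; the open stub of skeleton v15 remains `stub_adhesion_core`; rung F-C1 not
moved.
-/

noncomputable section

namespace Summit.Ventures.Crystal3D.Theorems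

open Summit.Ventures.Crystal3D Finset
open Literature.MathematicalPhysics.StatisticalMechanics (fccStacking contactDeficiency)
open scoped InnerProductSpace

/-- **RUNG (registered by name on stmt-Ventures-19144): misoriented fcc-grain films at every normal
gain nothing.**  See the module docstring. -/
theorem grainFilm_slab :
    ∃ R C : ℝ, 1 ≤ R ∧ ∀ U₀ : Finset (EuclideanSpace ℝ (Fin 3)),
      (∀ d ∈ U₀, d ∈ fccStacking 1 (Real.sqrt (2 / 3)) ∧ ‖d‖ = 1) → (∀ d ∈ U₀, -d ∈ U₀) → U₀.card = 12 →
      ∀ A : EuclideanSpace ℝ (Fin 3) ≃ₗᵢ[ℝ] EuclideanSpace ℝ (Fin 3),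
      ∀ ν : EuclideanSpace ℝ (Fin 3), ‖ν‖ = 1 → ∀ ρ : ℝ, R ≤ ρ →
      ∀ X P : Finset (EuclideanSpace ℝ (Fin 3)),
      (∀ p ∈ X, ∀ q ∈ X, p ≠ q → 1 ≤ dist p q) → P ⊆ X →
      (∀ p, p ∈ P ↔ (p ∈ fccStacking 1 (Real.sqrt (2 / 3)) ∧ -(2 * R) ≤ ⟪p, ν⟫_ℝ ∧
        ⟪p, ν⟫_ℝ ≤ -R ∧ ‖p‖ ^ 2 - ⟪p, ν⟫_ℝ ^ 2 ≤ ρ ^ 2)) →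
      (∀ q ∈ X \ P, -R < ⟪q, ν⟫_ℝ) →
      (∀ q ∈ X \ P, q ∉ fccStacking 1 (Real.sqrt (2 / 3))) →
      (∀ q ∈ X \ P, ∀ x ∈ X \ P, dist q x = 1 → A.symm (x - q) ∈ fccStacking 1 (Real.sqrt (2 / 3))) →
      ((((P ×ˢ (X \ P)).filter fun pq => dist pq.1 pq.2 = 1).card : ℕ) : ℝ) ≤
        contactDeficiency (X \ P) + C * ρ := by
  obtain ⟨R, C, hR, h⟩ := grainFilm_slab_of_capBudget
  exact ⟨R, C, hR, fun U₀ h1 h2 h3 A => h U₀ h1 h2 h3 A (stub_frameCapBudget U₀ h1 h2 h3 A)⟩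

end Summit.Ventures.Crystal3D.Theorems

end
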